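import Mathlib.Analysis.InnerProductSpace.PiL2
import Mathlib.Geometry.Manifold.Instances.Real
import Mathlib.Topology.Sets.Opens
import HarnessLib

-- provenance: harness21/H21/H21/Prelude/Lorentz/Basic.lean @ c144f38 (interim HEAD d8f2665); M5 mechanical rewrite
/-!
# Lorentzian geometry prelude, C0: shared coordinate conventions

Trunk G08 (T-LORENTZ), family `gr`. This file fixes once and for all the Cartesian model
spaces used by the explicit Kerr–Schwarzschild–Minkowski family (ingoing Kerr–Schild
Cartesian coordinates `(t*, x, y, z)`, cf. Dafermos–Rodnianski, *Lectures on black holes and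
linear waves*, arXiv:0811.0354, §2 and §5.1; Kerr–Schild 1965):

* `E3 = EuclideanSpace ℝ (Fin 3)` (spatial slices) and `E4 = EuclideanSpace ℝ (Fin 4)`
  (spacetime charts), with the convention that index `0` of `E4` is the time coordinate `t*`
  and indices `1, 2, 3` are the spatial coordinates;
* the coordinate maps `E4.time`, `E4.spatial` (a continuous linear map dropping index `0`),
  the inverse assembly `E4.ofTimeSpace`, and `E4.spatialNorm`;
* the exterior region `exteriorRegion R = {x : E3 | R < ‖x‖}` as an open subset (the model of
  an asymptotically flat end);
* the `rfl` lemmas identifying `𝓡 3`, `𝓡 4` with `𝓘(ℝ, E3)`, `𝓘(ℝ, E4)`.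

Mathlib already provides everything else used at this level and we do not redefine it:
`EuclideanSpace`, `EuclideanSpace.proj`, `EuclideanSpace.equiv`, the Euclidean bilinear
form `δ` as `innerSL ℝ`, `TopologicalSpace.Opens` with its charted-space/manifold structure,
and `𝓡 n = modelWithCornersSelf ℝ (EuclideanSpace ℝ (Fin n))`.

Design: `E3`, `E4` are `abbrev`s so that all `PiLp`/`EuclideanSpace` instances and simp
lemmas apply transparently; `E4.spatial` is bundled as `E4 →L[ℝ] E3` because it is used as
the differential of the slice embedding `y ↦ (0, y)`.
-/

noncomputable section

open scoped Manifold

namespace Literature.Geometry.Lorentzian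

/-- Euclidean `3`-space `ℝ³ = EuclideanSpace ℝ (Fin 3)`, the model of spatial slices and of
asymptotically flat ends (Dafermos–Rodnianski, arXiv:0811.0354, §2). [cite: arXiv08110354] -/
abbrev E3 : Type := EuclideanSpace ℝ (Fin 3)

/-- Cartesian `4`-space `ℝ⁴ = EuclideanSpace ℝ (Fin 4)`, the chart domain of Kerr–Schild
coordinates `(t*, x, y, z)`; index `0` is time, indices `1, 2, 3` are space
(Dafermos–Rodnianski, arXiv:0811.0354, §5.1). The Euclidean norm on `E4` is only used for
topology; the Lorentzian structure is `Minkowski.bilin` (file `Kerr.lean`). [cite: arXiv08110354] -/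
abbrev E4 : Type := EuclideanSpace ℝ (Fin 4)

namespace E4

/-- The time coordinate `t* = x 0` of a point of `E4` (Dafermos–Rodnianski,
arXiv:0811.0354, §5.1). [cite: arXiv08110354] -/
def time (x : E4) : ℝ := x 0

/-- The spatial part `(x 1, x 2, x 3) ∈ E3` of a point of `E4`, as a continuous linear map
(it is the projection along the time axis; Dafermos–Rodnianski, arXiv:0811.0354, §5.1). [cite: arXiv08110354] -/
def spatial : E4 →L[ℝ] E3 :=
  ((EuclideanSpace.equiv (Fin 3) ℝ).symm : (Fin 3 → ℝ) →L[ℝ] E3).comp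
    (ContinuousLinearMap.pi fun i : Fin 3 => EuclideanSpace.proj (𝕜 := ℝ) i.succ)

/-- Unfolding lemma for `E4.time` (coordinate convention, DR arXiv:0811.0354 §5.1). Not a
`simp` lemma: `time` is kept folded so that `ofTimeSpace_time_spatial` is in simp-normal
form. [cite: arXiv08110354] -/
theorem time_apply (x : E4) : time x = x 0 := rfl

/-- Components of `E4.spatial`: the `i`-th spatial coordinate is `x (i+1)` (DR
arXiv:0811.0354 §5.1). [cite: arXiv08110354] -/
@[simp]
theorem spatial_apply (x : E4) (i : Fin 3) : spatial x i = x i.succ := rfl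

/-- Assemble a point of `E4` from a time `t` and a spatial point `y ∈ E3`:
`ofTimeSpace t y = (t, y 0, y 1, y 2)` (Dafermos–Rodnianski, arXiv:0811.0354, §5.1). [cite: arXiv08110354] -/
def ofTimeSpace (t : ℝ) (y : E3) : E4 :=
  WithLp.toLp 2 (Matrix.vecCons t (WithLp.ofLp y))

/-- Component `0` of `(t, y)` is `t` (DR arXiv:0811.0354 §5.1). [cite: arXiv08110354] -/
@[simp]
theorem ofTimeSpace_apply_zero (t : ℝ) (y : E3) : ofTimeSpace t y 0 = t := rfl

/-- Component `i+1` of `(t, y)` is `y i` (DR arXiv:0811.0354 §5.1). [cite: arXiv08110354] -/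
@[simp]
theorem ofTimeSpace_apply_succ (t : ℝ) (y : E3) (i : Fin 3) :
    ofTimeSpace t y i.succ = y i := rfl

/-- The time coordinate of `(t, y)` is `t` (coordinate bookkeeping; Dafermos–Rodnianski,
arXiv:0811.0354, §5.1). [cite: arXiv08110354] -/
@[simp]
theorem time_ofTimeSpace (t : ℝ) (y : E3) : time (ofTimeSpace t y) = t := rfl

/-- The spatial part of `(t, y)` is `y` (coordinate bookkeeping; Dafermos–Rodnianski,
arXiv:0811.0354, §5.1). [cite: arXiv08110354] -/
@[simp]
theorem spatial_ofTimeSpace (t : ℝ) (y : E3) : spatial (ofTimeSpace t y) = y := by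
  ext i
  simp

/-- Every point of `E4` is `(t*, y)` with `t*` its time and `y` its spatial part
(coordinate bookkeeping; Dafermos–Rodnianski, arXiv:0811.0354, §5.1). [cite: arXiv08110354] -/
@[simp]
theorem ofTimeSpace_time_spatial (x : E4) : ofTimeSpace (time x) (spatial x) = x := by
  ext i
  refine Fin.cases ?_ (fun j => ?_) i
  · simp [time_apply]
  · simp

/-- `ofTimeSpace` is injective in the spatial variable (used for the slice embedding
`y ↦ (0, y)`; Dafermos–Rodnianski, arXiv:0811.0354, §5.1). [cite: arXiv08110354] -/
theorem ofTimeSpace_injective (t : ℝ) : Function.Injective (ofTimeSpace t) := by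
  intro y y' h
  simpa using congrArg spatial h

/-- The spatial (Euclidean) radius `‖(x 1, x 2, x 3)‖` of a point of `E4`; for `a = 0` this
is the Kerr–Schild/Schwarzschild area radius `r` (Dafermos–Rodnianski, arXiv:0811.0354,
§5.1). [cite: arXiv08110354] -/
def spatialNorm (x : E4) : ℝ := ‖spatial x‖

/-- The spatial radius of `(t, y)` is `‖y‖` (DR arXiv:0811.0354 §5.1). [cite: arXiv08110354] -/
@[simp]
theorem spatialNorm_ofTimeSpace (t : ℝ) (y : E3) : spatialNorm (ofTimeSpace t y) = ‖y‖ := by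
  simp [spatialNorm]

/-- The spatial radius is nonnegative (DR arXiv:0811.0354 §5.1). [cite: arXiv08110354] -/
theorem spatialNorm_nonneg (x : E4) : 0 ≤ spatialNorm x := norm_nonneg _

/-- `ofTimeSpace` is continuous in the spatial variable (Dafermos–Rodnianski,
arXiv:0811.0354, §5.1: the slice `{t* = const}` is an embedded copy of `E3`). [cite: arXiv08110354] -/
theorem continuous_ofTimeSpace (t : ℝ) : Continuous (ofTimeSpace t) := by
  refine (PiLp.continuous_toLp 2 _).comp ?_
  refine continuous_pi fun i => ?_
  refine Fin.cases ?_ (fun j => ?_) i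
  · simpa using continuous_const
  · simpa using (PiLp.continuous_apply 2 _ j)

end E4

/-- The exterior region `{x : E3 | R < ‖x‖}` as an open subset of `E3`: the model of an
asymptotically flat end (Bartnik, *The mass of an asymptotically flat manifold*, CPAM 39
(1986), §1; Dafermos–Rodnianski, arXiv:0811.0354, §2). No sign condition on `R`; for
`R < 0` it is all of `E3`. [cite: arXiv08110354] -/
def exteriorRegion (R : ℝ) : TopologicalSpace.Opens E3 :=
  ⟨{x | R < ‖x‖}, isOpen_lt continuous_const continuous_norm⟩

/-- Membership in the exterior region (Bartnik 1986, §1). [cite: Bartnik1986, §1] -/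
@[simp]
theorem mem_exteriorRegion {R : ℝ} {x : E3} : x ∈ exteriorRegion R ↔ R < ‖x‖ := Iff.rfl

/-- The exterior regions are antitone in the radius (Bartnik 1986, §1). [cite: Bartnik1986, §1] -/
theorem exteriorRegion_mono {R R' : ℝ} (h : R ≤ R') : exteriorRegion R' ≤ exteriorRegion R :=
  fun _ hx => lt_of_le_of_lt h hx

/-- Mathlib's `𝓡 3` is definitionally `𝓘(ℝ, E3)`; recorded so that both spellings may be
used interchangeably for manifolds modelled on `E3` (Mathlib,
`Geometry.Manifold.Instances.Real`). [folklore] -/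
theorem modelWithCornersSelf_euclidean_three : (𝓡 3) = 𝓘(ℝ, E3) := rfl

/-- Mathlib's `𝓡 4` is definitionally `𝓘(ℝ, E4)` (Mathlib, `Geometry.Manifold.Instances.Real`).
[folklore] -/
theorem modelWithCornersSelf_euclidean_four : (𝓡 4) = 𝓘(ℝ, E4) := rfl

end Literature.Geometry.Lorentzian
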